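import Literature.Topology.FourManifolds.LeeRasmussen
import Literature.Topology.FourManifolds.GaussDiagrams

/-!
# Sanity lemmas for the stereographic read-out (`planarProjection`, `height`) and the Lee filtration
# degree (`GaussDiagram.qMin`, `classDegree`) — pub-sp4mp REVIEW-RUNBOOK

Review evidence only (ops-runbook sanity registry `registry/pub-sp4mp.json`); no new definitions.

* `planarProjection x = ((1−x₃)⁻¹x₀, (1−x₃)⁻¹x₁)`, `height x = (1−x₃)⁻¹x₂`
  (`Literature/Topology/FourManifolds/GaussDiagrams.lean`): explicit values at the four coordinate
  points `±e_i` of `S³` — the equatorial point `e₀` projects to `(1, 0)` at height `0`, `e₂` to the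
  origin at height `1`, the south pole `−e₃` to the origin at height `0`, and the NORTH pole `e₃` to the
  documented junk value `(0, 0)` / `0` (`(1 − 1)⁻¹ = 0`);
* `qMin 0 = ⊤` (the empty infimum, as the docstring says) and `classDegree 0 = ⊤` (`s(0) = ⊤`), for
  every Gauss diagram (`Literature/Topology/FourManifolds/LeeRasmussen.lean`).
-/

namespace Summit.SmoothPoincare4.Runbook

open Literature.Topology.FourManifolds

/-! ## Stereographic read-out at the coordinate points of `S³` -/

/-- The coordinate point `e_i ∈ S³ ⊂ ℝ⁴`. (A term, not a definition of the theory: `EuclideanSpace.single`.) -/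
theorem norm_single_eq_one (i : Fin 4) :
    EuclideanSpace.single i (1 : ℝ) ∈ Metric.sphere (0 : EuclideanSpace ℝ (Fin 4)) 1 := by
  simp

/-- `−e_i ∈ S³`. -/
theorem norm_single_neg_eq_one (i : Fin 4) :
    EuclideanSpace.single i (-1 : ℝ) ∈ Metric.sphere (0 : EuclideanSpace ℝ (Fin 4)) 1 := by
  simp

/-- The equatorial point `e₀` projects to `(1, 0)`. -/
theorem planarProjection_e0 :
    planarProjection ⟨EuclideanSpace.single 0 (1 : ℝ), norm_single_eq_one 0⟩ = (1, 0) := by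
  simp [planarProjection]

/-- … at height `0`. -/
theorem height_e0 : height ⟨EuclideanSpace.single 0 (1 : ℝ), norm_single_eq_one 0⟩ = 0 := by
  simp [height]

/-- The point `e₂` projects to the origin of the plane … -/
theorem planarProjection_e2 :
    planarProjection ⟨EuclideanSpace.single 2 (1 : ℝ), norm_single_eq_one 2⟩ = (0, 0) := by
  simp [planarProjection]

/-- … at height `1` (it lies ABOVE the south pole, which also projects to the origin). -/
theorem height_e2 : height ⟨EuclideanSpace.single 2 (1 : ℝ), norm_single_eq_one 2⟩ = 1 := by
  simp [height]

/-- The south pole `−e₃` projects to the origin at height `0` (centre of the stereographic chart). -/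
theorem planarProjection_southPole :
    planarProjection ⟨EuclideanSpace.single 3 (-1 : ℝ), norm_single_neg_eq_one 3⟩ = (0, 0) := by
  simp [planarProjection]

/-- Height of the south pole is `0`. -/
theorem height_southPole : height ⟨EuclideanSpace.single 3 (-1 : ℝ), norm_single_neg_eq_one 3⟩ = 0 := by
  simp [height]

/-- The NORTH pole `e₃` gets the documented JUNK value `(0, 0)` (`(1 − 1)⁻¹ = 0` in Lean) — the
projection is only meaningful on `S³ ∖ {north pole}`, which is why knots are required to miss it. -/
theorem planarProjection_northPole_junk :
    planarProjection ⟨EuclideanSpace.single 3 (1 : ℝ), norm_single_eq_one 3⟩ = (0, 0) := by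
  simp [planarProjection]

/-- Junk height `0` at the north pole. -/
theorem height_northPole_junk : height ⟨EuclideanSpace.single 3 (1 : ℝ), norm_single_eq_one 3⟩ = 0 := by
  simp [height]

/-! ## Lee filtration degree of the zero chain / zero class -/

/-- `qMin 0 = ⊤`: the zero chain has empty support, so its filtration degree is the empty infimum. -/
theorem qMin_zero (G : GaussDiagram) : G.qMin 0 = ⊤ := by
  simp [GaussDiagram.qMin]

/-- `s(0) = ⊤`: the zero Lee class is represented by the zero cycle, whose `qMin` is `⊤`. -/
theorem classDegree_zero (G : GaussDiagram) : GaussDiagram.classDegree (G := G) 0 = ⊤ := by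
  apply le_antisymm le_top
  have h0 : G.qMin (0 : G.leeCycles).1 = ⊤ := by simp [qMin_zero]
  rw [← h0]
  unfold GaussDiagram.classDegree
  exact le_iSup₂ (f := fun (z : G.leeCycles) (_ : Submodule.Quotient.mk z = (0 : G.LeeHomologyZero)) =>
    G.qMin z.1) 0 (Submodule.Quotient.mk_zero _)

/-! ## The flipped chord behind `GaussDiagram.incidence` is UNIQUE (review-runbook «choose» side fact, 2026-09-05)

`GaussDiagram.incidence R h t s s'` (`Literature/Topology/FourManifolds/KhComplex.lean`) opens with
`if hi : ∃ i, s.state i = false ∧ s'.state = Function.update s.state i true then let i := Classical.choose hi …`: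
the chord `i` at which the `0`-smoothing of `s` is flipped to reach `s'`.  `Classical.choose` returns SOME witness; the
value is independent of the choice because the witness is unique — two states differing by one flip differ at exactly
one chord.  (The docstring of `incidence` says so: «such an `i` is unique»; this is its kernel form.) -/

/-- (c) **The chord flipped between `s.state` and `s'.state` is unique**: if `s'.state` is `s.state` updated to `true` at a
chord `i` where `s.state i = false`, and also at `i'`, then `i = i'` — so the `Classical.choose` in `incidence` does not
depend on the choice. [folklore] -/
theorem incidence_index_unique (G : GaussDiagram) (s s' : G.EnhancedState) (i i' : Fin G.n)
    (hi : s.state i = false ∧ s'.state = Function.update s.state i true)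
    (hi' : s.state i' = false ∧ s'.state = Function.update s.state i' true) : i = i' := by
  by_contra hne
  have h₁ : s'.state i = true := by rw [hi.2, Function.update_self]
  have h₂ : s'.state i = s.state i := by rw [hi'.2, Function.update_of_ne hne]
  rw [h₁, hi.1] at h₂
  exact Bool.noConfusion h₂

end Summit.SmoothPoincare4.Runbook
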